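import Literature.NumberTheory.EllipticCurves.SelmerGaloisAction
import Mathlib.Algebra.Polynomial.SpecificDegree
import Mathlib.FieldTheory.Normal.Basic
import Mathlib.FieldTheory.IsAlgClosed.AlgebraicClosure
import Mathlib.RingTheory.RootsOfUnity.PrimitiveRoots
import HarnessLib

/-!
# A Galois element acting as `[ω]` on the `2`-torsion of `y² = x³ + b` (`∛b ∉ K`)

Instantiation input (iii) of `Theorems/SylvesterTwoHeegnerIndexCoupledDescentF4Line.lean`
(`F4Line.simple`, `.commutant`, `.act_cases`, … take «some `z ∈ Γ` acts on `T` as `f`»): for a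
`j = 0` curve `V : y² = x³ + b` over a field `K ∋ ζ` of characteristic `0` (`ζ` a primitive cube
root of unity) such that `X³ + b` has NO root in `K`, and for any additive `φ` on `V(K̄)` with the
coordinate formula of the CM map `[ζ] : (x, y) ↦ (ζ²x, y)` (the shape delivered by
`JZero.exists_cm_isogeny_of_eq` / `exists_cm_operator_galH1Torsion`, k-ty1 p615303), there is
`z ∈ Γ_K = Aut(K̄/K)` with `z • P = φ P` for every `2`-torsion point `P ∈ V(K̄)`. Reason: the
`2`-torsion points are `O` and `(θᵢ, 0)` with `θᵢ³ = -b`, `θᵢ ∈ {θ, ζθ, ζ²θ}`; `X³ + b` is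
irreducible over `K` (degree `3`, no root), so it is the minimal polynomial of both `θ` and `ζ²θ`,
and `Aut(K̄/K)` is transitive on its roots (Mathlib `Normal.minpoly_eq_iff_mem_orbit`): some `z`
has `z θ = ζ² θ`, hence `z θᵢ = ζ² θᵢ` for all `i` (`z` fixes `ζ ∈ K`), i.e. `z` acts on `V[2]` as
`[ζ]`. This is the one arithmetic input per curve of the (L3) instantiation (memo two §57.1 (F1):
`K(E_p[2]) = K(∛(4p))`, `K(E_{3p²}[2]) = K(∛(18p))`, both cubic over `K = ℚ(ω)`).

* `two_torsion_eq` — a `2`-torsion point of `y² = x³ + b` over `K̄` is `O` or `(x, 0)`, `x³ = -b`.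
* `exists_absGal_apply_eq_mul_of_no_root` — `∃ z ∈ Aut(K̄/K)`, `z θ = ζ² θ`.
* `exists_absGal_smul_eq_of_no_cubeRoot` — the statement above.

Theorem-only; nothing about 19804 is asserted; no label moves; BSD not claimed.
-/

set_option linter.dupNamespace false -- Summits modules are `Summit.<Summit>.<Problem>…` by design

noncomputable section

open scoped Classical
open WeierstrassCurve Polynomial

universe u

namespace Summit.BirchSwinnertonDyer.BirchSwinnertonDyer.Theorems.SylvesterTwoCoupledDescentF4Galois

variable {K : Type u} [Field K] [CharZero K]

/-- **`2`-torsion points of `y² = x³ + b`** (over any extension `L` of characteristic `0`): a point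
`P` of `V = ⟨0,0,0,0,·⟩`-shape (`a₁ = a₂ = a₃ = a₄ = 0`) with `2 • P = 0` is `O` or `(x, 0)` with
`x³ + a₆ = 0`. (Negation is `(x, y) ↦ (x, -y - a₁x - a₃)`; `2 ≠ 0`.) -/
theorem two_torsion_eq {L : Type u} [Field L] [CharZero L] (V : WeierstrassCurve L)
    (h1 : V.a₁ = 0) (h2 : V.a₂ = 0) (h3 : V.a₃ = 0) (h4 : V.a₄ = 0)
    (P : V.toAffine.Point) (hP : (2 : ℕ) • P = 0) :
    P = 0 ∨ ∃ (x : L) (h : V.toAffine.Nonsingular x 0), x ^ 3 + V.a₆ = 0 ∧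
      P = Affine.Point.some x 0 h := by
  rw [two_nsmul, add_eq_zero_iff_eq_neg] at hP
  rcases P with _ | ⟨x, y, h⟩
  · exact Or.inl rfl
  · right
    rw [Affine.Point.neg_some, Affine.Point.some.injEq] at hP
    have hy : y = 0 := by
      have e := hP.2
      rw [Affine.negY, h1, h3] at e
      -- `e : y = -y - 0 * x - 0`
      have : (2 : L) * y = 0 := by linear_combination e
      simpa using this
    subst hy
    refine ⟨x, h, ?_, rfl⟩
    have heq := (Affine.equation_iff x 0).mp h.1
    rw [h1, h2, h3, h4] at heq
    linear_combination -heq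

/-- **Transitivity of `Aut(K̄/K)` on the roots of an irreducible cubic `X³ + c`**: if `X³ + c`
has no root in `K`, `θ ∈ K̄` is a root and `ξ ∈ K` is a cube root of unity, then some
`z ∈ Aut(K̄/K)` has `z θ = ξ θ` (both are roots of the irreducible `X³ + c = minpoly_K θ`; Mathlib
`Normal.minpoly_eq_iff_mem_orbit` for the normal extension `K̄/K`). -/
theorem exists_absGal_apply_eq_mul_of_no_root {c : K} (hc : ∀ t : K, t ^ 3 + c ≠ 0)
    {θ : AlgebraicClosure K} (hθ : θ ^ 3 + algebraMap K _ c = 0) {ξ : K} (hξ : ξ ^ 3 = 1) :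
    ∃ z : AlgebraicClosure K ≃ₐ[K] AlgebraicClosure K, z θ = algebraMap K _ ξ * θ := by
  set p : K[X] := X ^ 3 + C c with hp
  have hdeg : p.natDegree = 3 := by rw [hp]; exact natDegree_X_pow_add_C
  have hmon : p.Monic := by rw [hp]; exact monic_X_pow_add_C c (by norm_num)
  have hirr : Irreducible p := by
    refine irreducible_of_degree_le_three_of_not_isRoot (by rw [hdeg]; decide) fun t ht ↦ ?_
    rw [hp, IsRoot, eval_add, eval_pow, eval_X, eval_C] at ht
    exact hc t ht
  have haeval : ∀ w : AlgebraicClosure K, w ^ 3 + algebraMap K _ c = 0 → aeval w p = 0 := by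
    intro w hw; rw [hp, map_add, map_pow, aeval_X, aeval_C]; exact hw
  have hθ' : (algebraMap K (AlgebraicClosure K) ξ * θ) ^ 3 + algebraMap K _ c = 0 := by
    rw [mul_pow, ← map_pow, hξ, map_one, one_mul]; exact hθ
  have hmin : minpoly K (algebraMap K (AlgebraicClosure K) ξ * θ) = minpoly K θ := by
    rw [← minpoly.eq_of_irreducible_of_monic hirr (haeval _ hθ') hmon,
      ← minpoly.eq_of_irreducible_of_monic hirr (haeval _ hθ) hmon]
  obtain ⟨z, hz⟩ := MulAction.mem_orbit_iff.mp ((Normal.minpoly_eq_iff_mem_orbit (F := K)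
    (E := AlgebraicClosure K)).mp hmin)
  exact ⟨z, hz⟩

/-- **A Galois element acting as `[ζ]` on `V[2]`.** `V` over `K` (char. `0`) with
`a₁ = a₂ = a₃ = a₄ = 0` and `X³ + a₆` without root in `K`; `ζ ∈ K` a primitive cube root of unity;
`φ` an additive map of `V(K̄)` with `φ (x, y) = (ζ² x, y)`. Then some `z ∈ Γ_K` satisfies
`z • P = φ P` for every `P ∈ V(K̄)` with `2 • P = 0`. With
`SylvesterTwoCoupledDescentF4Line.F4Line.act_cases` this is the hypothesis `hz` of
`F4Line.simple` / `.commutant` for `T = V[2]`. -/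
theorem exists_absGal_smul_eq_of_no_cubeRoot (V : WeierstrassCurve K)
    (h1 : V.a₁ = 0) (h2 : V.a₂ = 0) (h3 : V.a₃ = 0) (h4 : V.a₄ = 0)
    (hb : ∀ t : K, t ^ 3 + V.a₆ ≠ 0) {ζ : K} (hζ : IsPrimitiveRoot ζ 3)
    (φ : geomPoints V →+ geomPoints V)
    (hφ : ∀ (x y : AlgebraicClosure K)
      (h : (V.baseChange (AlgebraicClosure K)).toAffine.Nonsingular x y),
      ∃ h', φ (Affine.Point.some x y h) =
        Affine.Point.some (algebraMap K (AlgebraicClosure K) ζ ^ 2 * x) y h') :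
    ∃ z : Field.absoluteGaloisGroup K, ∀ P : geomPoints V, (2 : ℕ) • P = 0 → z • P = φ P := by
  set L := AlgebraicClosure K
  -- a root `θ` of `X³ + a₆` in `K̄`, and `z` with `z θ = ζ² θ`
  obtain ⟨θ, hθ⟩ := IsAlgClosed.exists_pow_nat_eq (-(algebraMap K L V.a₆)) (by norm_num : 0 < 3)
  have hθ' : θ ^ 3 + algebraMap K L V.a₆ = 0 := by rw [hθ, neg_add_cancel]
  have hζ3 : ζ ^ 3 = 1 := hζ.pow_eq_one
  have hζ2 : (ζ ^ 2) ^ 3 = 1 := by rw [← pow_mul, mul_comm, pow_mul, hζ3, one_pow]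
  obtain ⟨z, hz⟩ := exists_absGal_apply_eq_mul_of_no_root hb hθ' hζ2
  set g : Field.absoluteGaloisGroup K := z with hg
  refine ⟨g, fun P hP ↦ ?_⟩
  -- the base-changed curve has `a₁ = … = a₄ = 0`, `a₆ ↦ algebraMap a₆`
  have e1 : (V.baseChange L).a₁ = 0 := by simp [WeierstrassCurve.baseChange, h1]
  have e2 : (V.baseChange L).a₂ = 0 := by simp [WeierstrassCurve.baseChange, h2]
  have e3 : (V.baseChange L).a₃ = 0 := by simp [WeierstrassCurve.baseChange, h3]
  have e4 : (V.baseChange L).a₄ = 0 := by simp [WeierstrassCurve.baseChange, h4]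
  have e6 : (V.baseChange L).a₆ = algebraMap K L V.a₆ := by simp [WeierstrassCurve.baseChange]
  rcases two_torsion_eq (V.baseChange L) e1 e2 e3 e4 P hP with rfl | ⟨x, h, hx, rfl⟩
  · change Affine.Point.map (z : L →ₐ[K] L) 0 = φ 0
    rw [map_zero, map_zero]
    rfl
  · -- `x = ζ^j θ`, so `z x = ζ² x`
    rw [e6] at hx
    have hθ0 : θ ≠ 0 := by
      rintro rfl
      have ha : algebraMap K L V.a₆ = 0 := by simpa using hθ'
      have ha6 : V.a₆ = 0 := (algebraMap K L).injective (by rw [ha, map_zero])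
      exact hb 0 (by rw [ha6]; ring)
    have hζL : IsPrimitiveRoot (algebraMap K L ζ) 3 := hζ.map_of_injective (algebraMap K L).injective
    have hcube : (x / θ) ^ 3 = 1 := by
      rw [div_pow, div_eq_one_iff_eq (pow_ne_zero 3 hθ0)]
      linear_combination hx - hθ'
    obtain ⟨j, -, hj⟩ := hζL.eq_pow_of_pow_eq_one hcube
    have hxθ : x = algebraMap K L ζ ^ j * θ := by
      rw [hj, div_mul_cancel₀ x hθ0]
    have hzx : z x = algebraMap K L ζ ^ 2 * x := by
      rw [hxθ, map_mul, map_pow, AlgEquiv.commutes, hz, map_pow]; ring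
    obtain ⟨h', hφP⟩ := hφ x 0 h
    rw [hφP]
    change Affine.Point.map (z : L →ₐ[K] L) (Affine.Point.some x 0 h) = _
    simp only [Affine.Point.map_some, map_zero]
    exact Affine.Point.some_eq_some_of_eq hzx rfl

/-! ## Across two curves: an element fixing `B[2]` and acting as `[ζ]` on `A[2]` (appended) -/

/-- **Transitivity over an intermediate base.** For an intermediate field `F` of `K̄/K`, if
`X³ + c` (`c ∈ K`) has no root in `F` and `θ ∈ K̄` is a root, then for every cube root of unity
`ξ ∈ K` some `z ∈ Aut(K̄/K)` FIXING `F` pointwise has `z θ = ξ θ` (the orbit argument over `F`,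
`K̄/F` being normal; then restrict scalars to `K`). -/
theorem exists_absGal_fix_apply_eq_mul_of_no_root (F : IntermediateField K (AlgebraicClosure K))
    {c : K} (hc : ∀ t : AlgebraicClosure K, t ∈ F → t ^ 3 + algebraMap K _ c ≠ 0)
    {θ : AlgebraicClosure K} (hθ : θ ^ 3 + algebraMap K _ c = 0) {ξ : K} (hξ : ξ ^ 3 = 1) :
    ∃ z : AlgebraicClosure K ≃ₐ[K] AlgebraicClosure K,
      (∀ t : AlgebraicClosure K, t ∈ F → z t = t) ∧ z θ = algebraMap K _ ξ * θ := by
  haveI : Normal F (AlgebraicClosure K) := Normal.tower_top_of_normal K F (AlgebraicClosure K)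
  set p : F[X] := X ^ 3 + C (algebraMap K F c) with hp
  have hdeg : p.natDegree = 3 := by rw [hp]; exact natDegree_X_pow_add_C
  have hmon : p.Monic := by rw [hp]; exact monic_X_pow_add_C _ (by norm_num)
  have hKF : ∀ x : K, algebraMap F (AlgebraicClosure K) (algebraMap K F x) =
      algebraMap K (AlgebraicClosure K) x := fun x ↦ (IsScalarTower.algebraMap_apply K F _ x).symm
  have hirr : Irreducible p := by
    refine irreducible_of_degree_le_three_of_not_isRoot (by rw [hdeg]; decide) fun t ht ↦ ?_
    rw [hp, IsRoot, eval_add, eval_pow, eval_X, eval_C] at ht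
    apply hc (t : AlgebraicClosure K) t.2
    have := congrArg (algebraMap F (AlgebraicClosure K)) ht
    rw [map_add, map_pow, hKF, map_zero] at this
    exact this
  have haeval : ∀ w : AlgebraicClosure K, w ^ 3 + algebraMap K _ c = 0 → aeval w p = 0 := by
    intro w hw; rw [hp, map_add, map_pow, aeval_X, aeval_C, hKF]; exact hw
  have hθ' : (algebraMap K (AlgebraicClosure K) ξ * θ) ^ 3 + algebraMap K _ c = 0 := by
    rw [mul_pow, ← map_pow, hξ, map_one, one_mul]; exact hθ
  have hmin : minpoly F (algebraMap K (AlgebraicClosure K) ξ * θ) = minpoly F θ := by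
    rw [← minpoly.eq_of_irreducible_of_monic hirr (haeval _ hθ') hmon,
      ← minpoly.eq_of_irreducible_of_monic hirr (haeval _ hθ) hmon]
  obtain ⟨zF, hzF⟩ := MulAction.mem_orbit_iff.mp ((Normal.minpoly_eq_iff_mem_orbit (F := F)
    (E := AlgebraicClosure K)).mp hmin)
  refine ⟨zF.restrictScalars K, fun t ht ↦ ?_, hzF⟩
  exact zF.commutes (⟨t, ht⟩ : F)

/-- **(Z) for a pair of `j = 0` curves.** `VA, VB` over `K ∋ ζ` (char. `0`) with
`a₁ = … = a₄ = 0`; `θB ∈ K̄` with `θB³ + a₆(VB) = 0`; and `X³ + a₆(VA)` without root in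
`K(θB)` (Kummer independence of the two cubic fields — for the HSY pair `K(∛(4p)) ≠ K(∛(18p))`).
Then some `z ∈ Γ_K` FIXES every `2`-torsion point of `VB` and acts as `[ζ]` (`φA`, coordinate
formula `(x, y) ↦ (ζ²x, y)`) on the `2`-torsion of `VA` — the hypothesis `hzA`/`hzB` (with
`F4Line.act_cases`, the element `zA ∈ Γ_{K(B[2])}` moving every non-zero point of `A[2]`) of
`exists_h1Eval_eq_pair_of_comm` (p625298). -/
theorem exists_absGal_fix_and_smul_eq (VA VB : WeierstrassCurve K)
    (hA1 : VA.a₁ = 0) (hA2 : VA.a₂ = 0) (hA3 : VA.a₃ = 0) (hA4 : VA.a₄ = 0)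
    (hB1 : VB.a₁ = 0) (hB2 : VB.a₂ = 0) (hB3 : VB.a₃ = 0) (hB4 : VB.a₄ = 0)
    {ζ : K} (hζ : IsPrimitiveRoot ζ 3)
    {θB : AlgebraicClosure K} (hθB : θB ^ 3 + algebraMap K _ VB.a₆ = 0)
    (hZ : ∀ t : AlgebraicClosure K, t ∈ IntermediateField.adjoin K {θB} →
      t ^ 3 + algebraMap K _ VA.a₆ ≠ 0)
    (φA : geomPoints VA →+ geomPoints VA)
    (hφA : ∀ (x y : AlgebraicClosure K)
      (h : (VA.baseChange (AlgebraicClosure K)).toAffine.Nonsingular x y),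
      ∃ h', φA (Affine.Point.some x y h) =
        Affine.Point.some (algebraMap K (AlgebraicClosure K) ζ ^ 2 * x) y h') :
    ∃ z : Field.absoluteGaloisGroup K,
      (∀ P : geomPoints VB, (2 : ℕ) • P = 0 → z • P = P) ∧
      (∀ P : geomPoints VA, (2 : ℕ) • P = 0 → z • P = φA P) := by
  have hζ3 : ζ ^ 3 = 1 := hζ.pow_eq_one
  have hζ2 : (ζ ^ 2) ^ 3 = 1 := by rw [← pow_mul, mul_comm, pow_mul, hζ3, one_pow]
  have hζL : IsPrimitiveRoot (algebraMap K (AlgebraicClosure K) ζ) 3 :=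
    hζ.map_of_injective (algebraMap K (AlgebraicClosure K)).injective
  -- a root `θA` of `X³ + a₆(VA)` and the element `z`
  obtain ⟨θA, hθA⟩ := IsAlgClosed.exists_pow_nat_eq (-(algebraMap K (AlgebraicClosure K) VA.a₆)) (by norm_num : 0 < 3)
  have hθA' : θA ^ 3 + algebraMap K (AlgebraicClosure K) VA.a₆ = 0 := by rw [hθA, neg_add_cancel]
  obtain ⟨z, hzF, hz⟩ := exists_absGal_fix_apply_eq_mul_of_no_root
    (IntermediateField.adjoin K {θB}) hZ hθA' hζ2
  have hzB : z θB = θB := hzF θB (IntermediateField.mem_adjoin_simple_self K θB)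
  set g : Field.absoluteGaloisGroup K := z with hg
  -- roots of `X³ + c` are `ζ^j θ`
  have roots : ∀ {c : K} {θ x : AlgebraicClosure K}, (∀ t : K, t ^ 3 + c ≠ 0) → θ ^ 3 + algebraMap K (AlgebraicClosure K) c = 0 →
      x ^ 3 + algebraMap K (AlgebraicClosure K) c = 0 → ∃ j : ℕ, x = algebraMap K (AlgebraicClosure K) ζ ^ j * θ := by
    intro c θ x hc hθ hx
    have hθ0 : θ ≠ 0 := by
      rintro rfl
      have ha : algebraMap K (AlgebraicClosure K) c = 0 := by simpa using hθ
      have hc0 : c = 0 := (algebraMap K (AlgebraicClosure K)).injective (by rw [ha, map_zero])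
      exact hc 0 (by rw [hc0]; ring)
    have hcube : (x / θ) ^ 3 = 1 := by
      rw [div_pow, div_eq_one_iff_eq (pow_ne_zero 3 hθ0)]
      linear_combination hx - hθ
    obtain ⟨j, -, hj⟩ := hζL.eq_pow_of_pow_eq_one hcube
    exact ⟨j, by rw [hj, div_mul_cancel₀ x hθ0]⟩
  -- no root of `X³ + a₆(VA)` in `K`, none of `X³ + a₆(VB)` needed: `hZ` restricted to `K`
  have hbA : ∀ t : K, t ^ 3 + VA.a₆ ≠ 0 := fun t ht ↦
    hZ (algebraMap K (AlgebraicClosure K) t) (IntermediateField.algebraMap_mem _ t)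
      (by rw [← map_pow, ← map_add, ht, map_zero])
  refine ⟨g, fun P hP ↦ ?_, fun P hP ↦ ?_⟩
  · -- `B`-side: `z` fixes `ζ^j θB`
    have e1 : (VB.baseChange (AlgebraicClosure K)).a₁ = 0 := by simp [WeierstrassCurve.baseChange, hB1]
    have e2 : (VB.baseChange (AlgebraicClosure K)).a₂ = 0 := by simp [WeierstrassCurve.baseChange, hB2]
    have e3 : (VB.baseChange (AlgebraicClosure K)).a₃ = 0 := by simp [WeierstrassCurve.baseChange, hB3]
    have e4 : (VB.baseChange (AlgebraicClosure K)).a₄ = 0 := by simp [WeierstrassCurve.baseChange, hB4]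
    have e6 : (VB.baseChange (AlgebraicClosure K)).a₆ = algebraMap K (AlgebraicClosure K) VB.a₆ := by simp [WeierstrassCurve.baseChange]
    rcases two_torsion_eq (VB.baseChange (AlgebraicClosure K)) e1 e2 e3 e4 P hP with rfl | ⟨x, h, hx, rfl⟩
    · change Affine.Point.map (z : AlgebraicClosure K →ₐ[K] AlgebraicClosure K) 0 = 0
      exact map_zero _
    · rw [e6] at hx
      -- either `θB = 0` (then `a₆ = 0` and `x = 0`) or `x = ζ^j θB`
      have hzx : z x = x := by
        by_cases hθ0 : θB = 0
        · have ha : algebraMap K (AlgebraicClosure K) VB.a₆ = 0 := by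
            rw [hθ0] at hθB; simpa using hθB
          have hx0 : x = 0 := by
            have : x ^ 3 = 0 := by rw [ha, add_zero] at hx; exact hx
            exact pow_eq_zero_iff (n := 3) (by norm_num) |>.mp this
          rw [hx0, map_zero]
        · have hcube : (x / θB) ^ 3 = 1 := by
            rw [div_pow, div_eq_one_iff_eq (pow_ne_zero 3 hθ0)]
            linear_combination hx - hθB
          obtain ⟨j, -, hj⟩ := hζL.eq_pow_of_pow_eq_one hcube
          have hxθ : x = algebraMap K (AlgebraicClosure K) ζ ^ j * θB := by rw [hj, div_mul_cancel₀ x hθ0]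
          rw [hxθ, map_mul, map_pow, AlgEquiv.commutes, hzB]
      change Affine.Point.map (z : AlgebraicClosure K →ₐ[K] AlgebraicClosure K) (Affine.Point.some x 0 h) = _
      simp only [Affine.Point.map_some, map_zero]
      exact Affine.Point.some_eq_some_of_eq hzx rfl
  · -- `A`-side: `z (ζ^j θA) = ζ² (ζ^j θA)`
    have e1 : (VA.baseChange (AlgebraicClosure K)).a₁ = 0 := by simp [WeierstrassCurve.baseChange, hA1]
    have e2 : (VA.baseChange (AlgebraicClosure K)).a₂ = 0 := by simp [WeierstrassCurve.baseChange, hA2]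
    have e3 : (VA.baseChange (AlgebraicClosure K)).a₃ = 0 := by simp [WeierstrassCurve.baseChange, hA3]
    have e4 : (VA.baseChange (AlgebraicClosure K)).a₄ = 0 := by simp [WeierstrassCurve.baseChange, hA4]
    have e6 : (VA.baseChange (AlgebraicClosure K)).a₆ = algebraMap K (AlgebraicClosure K) VA.a₆ := by simp [WeierstrassCurve.baseChange]
    rcases two_torsion_eq (VA.baseChange (AlgebraicClosure K)) e1 e2 e3 e4 P hP with rfl | ⟨x, h, hx, rfl⟩
    · change Affine.Point.map (z : AlgebraicClosure K →ₐ[K] AlgebraicClosure K) 0 = φA 0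
      rw [map_zero, map_zero]; rfl
    · rw [e6] at hx
      obtain ⟨j, hj⟩ := roots hbA hθA' hx
      have hzx : z x = algebraMap K (AlgebraicClosure K) ζ ^ 2 * x := by
        rw [hj, map_mul, map_pow, AlgEquiv.commutes, hz, map_pow]; ring
      obtain ⟨h', hφP⟩ := hφA x 0 h
      rw [hφP]
      change Affine.Point.map (z : AlgebraicClosure K →ₐ[K] AlgebraicClosure K) (Affine.Point.some x 0 h) = _
      simp only [Affine.Point.map_some, map_zero]
      exact Affine.Point.some_eq_some_of_eq hzx rfl

/-! ## Complex conjugation is semilinear on points: `τ ∘ [ζ] = [ζ]² ∘ τ` (appended) -/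

section Semilinear

open Literature.NumberTheory.EllipticCurves

variable {k : Type u} {K' : Type u} [Field k] [Field K'] [Algebra k K']
  {σ : K' ≃ₐ[k] K'} {τ : AlgebraicClosure K' ≃+* AlgebraicClosure K'}

/-- **`τ (φ P) = φ (φ (τ P))`** for a lift `τ` of `σ ∈ Aut(K/k)` with `σ ζ = ζ²` and any
additive `φ` on `E(K̄)` (`E = W/k`) with the coordinate formula `φ (x, y) = (ζ² x, y)`: on an
affine point both sides are `(ζ⁴ τx, τy)`. This is the point-level form of
`hτw` (`τ (w P) = w (w (τ P))` on `E[2]`, via `IsLiftOfAut.coe_torsionMap`) used by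
`F4Line.exists_e0`; k-ty1's `exists_cm_operator_galH1Torsion` proves it privately for its `H¹`
package. -/
theorem IsLiftOfAut.pointsMap_apply_cm (W : WeierstrassCurve k) (hτ : IsLiftOfAut σ τ)
    {ζ : K'} (hσζ : σ ζ = ζ ^ 2)
    (φ : geomPoints (W.baseChange K') →+ geomPoints (W.baseChange K'))
    (hφ : ∀ (x y : AlgebraicClosure K')
      (h : ((W.baseChange K').baseChange (AlgebraicClosure K')).toAffine.Nonsingular x y),
      ∃ h', φ (Affine.Point.some x y h) =
        Affine.Point.some (algebraMap K' (AlgebraicClosure K') ζ ^ 2 * x) y h')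
    (P : geomPoints (W.baseChange K')) :
    hτ.pointsMap W (φ P) = φ (φ (hτ.pointsMap W P)) := by
  change ((W.baseChange K').baseChange (AlgebraicClosure K')).toAffine.Point at P
  rcases P with _ | ⟨x, y, h⟩
  · change hτ.pointsMap W (φ 0) = φ (φ (hτ.pointsMap W 0))
    rw [map_zero, map_zero, map_zero, map_zero]
  · obtain ⟨h1, e1⟩ := hφ x y h
    rw [e1]
    -- `τ (x, y) = (τ x, τ y)` as a point of `W⁄K̄`
    have hτP : ∀ (a b : AlgebraicClosure K')
        (hab : ((W.baseChange K').baseChange (AlgebraicClosure K')).toAffine.Nonsingular a b),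
        ∃ hab', hτ.pointsMap W (Affine.Point.some a b hab) = Affine.Point.some (τ a) (τ b) hab' := by
      intro a b hab
      refine ⟨?_, ?_⟩
      swap
      · change WeierstrassCurve.Affine.Point.map (W' := W)
            (hτ.algEquiv : AlgebraicClosure K' →ₐ[k] AlgebraicClosure K') (.some a b hab) = _
        rw [Affine.Point.map_some]
        rfl
    obtain ⟨h2, e2⟩ := hτP _ _ h1
    obtain ⟨h3, e3⟩ := hτP x y h
    rw [e2, e3]
    obtain ⟨h4, e4⟩ := hφ (τ x) (τ y) h3
    rw [e4]
    obtain ⟨h5, e5⟩ := hφ _ _ h4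
    rw [e5]
    have hτζ : τ (algebraMap K' (AlgebraicClosure K') ζ) =
        algebraMap K' (AlgebraicClosure K') ζ ^ 2 := by
      rw [hτ ζ, hσζ, map_pow]
    refine Affine.Point.some_eq_some_of_eq ?_ rfl
    rw [map_mul, map_pow, hτζ, ← mul_assoc, ← pow_add, ← pow_mul]

end Semilinear

end Summit.BirchSwinnertonDyer.BirchSwinnertonDyer.Theorems.SylvesterTwoCoupledDescentF4Galois

end
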